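import Literature.GroupTheory.SpecificGroups.PGL2CountingCharP
import Literature.NumberTheory.Automorphic.Sweep1SymmetricPowerNewtonThorneProofs
import HarnessLib

/-!
# Finite subgroups of `PGL₂(k)` in characteristic `p`, IV: the subgroups `PSL₂(𝔽_q)`, `PGL₂(𝔽_q)`
of a subfield and Faber's §6.1.1 (`Λ = (𝔽_qˣ)²`, `q > 3` ⇒ `H = PSL₂(𝔽_q)`)

Topic `GroupTheory/SpecificGroups`; theorems plus small definitions (`pglTwo F`, `pslTwo F`, the
normal-form predicate `IsNormalised`, `lambdaToUnits`), no named facts.  Fourth part of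
Dickson's classification of the finite `p`-irregular subgroups of `PGL₂(k)` following X. Faber,
*Finite `p`-irregular subgroups of `PGL₂(k)*`, arXiv:1112.1999 = La Matematica 2 (2023)
[Faber2011], §6.1 (the case `Λ = (𝔽_qˣ)²`) and §6.1.1 (`p > 2`, `q > 3`), after L. E. Dickson,
*Linear groups* (1901), Ch. XII [Dickson1901]; parts I–III are `PGL2SylowCharP`,
`PGL2BorelCharP`, `PGL2CountingCharP`.  Use: the input "the classification of finite subgroups of
`PGL₂(𝔽̄_q)` shows that the projective image … contains `PSL₂(𝔽_{q^a})` and is contained in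
`PGL₂(𝔽_{q^a})`" of Newton–Thorne, *Symmetric power functoriality, II*, Publ. IHES 134 (2021),
proof of Prop. 3.7 [NewtonThorneIHES2021b].  The orders of `PGL₂(𝔽_q)`/`PSL₂(𝔽_q)` come from
`Literature.NumberTheory.Automorphic.NewtonThorne2021.natCard_projGenLinGroup_fin_two` /
`index_range_toPGL` (a Mathlib-only file).

## Contents (all proved)

* `pglTwo F`, `pslTwo F ≤ PGL₂(k)` for a subfield `F ≤ k` (images of `PGL₂(F)`, `SL₂(F)`),
  `mk_mem_pglTwo_of_forall_mem` / `mk_mem_pslTwo_of_forall_mem` (membership from rational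
  entries), `transl_mem_pslTwo`, `homoth_mul_self_mem_pslTwo` (`δ_{η²} = [diag(η, η⁻¹)]`),
  `homoth_mem_pglTwo`, **`card_pglTwo`** (`|PGL₂(𝔽_q)| = q(q²-1)`), **`two_mul_card_pslTwo`**
  (`2|PSL₂(𝔽_q)| = q(q²-1)`, `q` odd).
* `IsNormalised p H` — Faber's normal form (§6: a Sylow `p`-subgroup `P ≠ 1` fixes `∞` and is
  not normal, `N = P ⋊ (Λ 0; 0 1)`, `1 ∈ Γ`), with `IsNormalised.card_stabField` (`|𝔽_Γ| = q`),
  `mem_Gamma_iff` (**`Γ(H) = 𝔽_q`**), `transl_mem`, `card_Lambda_eq_or`; `lambdaToUnits`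
  (`Λ ↪ 𝔽_qˣ`), `index_range_lambdaToUnits`, **`mul_self_mem_Lambda`** and
  **`exists_mul_self_eq_of_mem_Lambda`** (`2d = q - 1`, `p` odd ⇒ `Λ` = the squares of `𝔽_qˣ`,
  Faber's "`Λ = (𝔽_qˣ)²`").
* The rationality computation of §6.1.1: `exists_mem_ne_zero_sq_ne_one` (an `η ∈ 𝔽_q` with
  `η ≠ 0, ±1` for `q > 3`), `eval_cosetQuad_eq_zero_iff` (the two roots
  `μ_± = (±2η - (αη² + δ))/γ` of Faber's (6.1.2)), **`forall_mem_of_roots_mem`** ("`γ_i ∈ 𝔽_q` …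
  `α_i ∈ 𝔽_q`, `δ_i = 2 - α_i`, `β_i ∈ 𝔽_q`").
* `IsNormalised.shiftInfty_mem`, `exists_ne_and_fibre` (two distinct solutions per multiplier,
  from the equality case of part III), **`mem_pslTwo_of_pow_char_eq_one`** (a `p`-element not
  fixing `∞` lies in `PSL₂(𝔽_q)`), `coe_stabilizer_mem_pslTwo`, `le_pslTwo`, `mul_le_card`
  (`q d (q+1) ≤ |H|`), and the conclusion **`IsNormalised.eq_pslTwo`: for `k` algebraically closed
  of odd characteristic `p`, `H` finite in normal form with `2|Λ| = q - 1` and `q > 3`,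
  `H = PSL₂(𝔽_q)`** (Faber Thm. 6.1 / §6.1.1).

## What is NOT here

§6.1.1 for `q = 3` (`H = PSL₂(𝔽_3)` after a further translation), §6.1.2–6.1.3 (`p = 2`), §6.2
(`Λ = 𝔽_qˣ`: `H = PGL₂(𝔽_q)` or `𝔄₅`) and the assembled classification with the reduction of an
arbitrary finite `H` to normal form: later parts.

## References

* [Faber2011] X. Faber, *Finite p-irregular subgroups of PGL₂(k)*, arXiv:1112.1999 (2011); La
  Matematica 2 (2023) 479–522 — Thm. 6.1, Lemma 6.3, §6.1, §6.1.1 (read 2026-08-15, chunks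
  p0016–p0017).
* [Dickson1901] L. E. Dickson, *Linear groups with an exposition of the Galois field theory*,
  Teubner (1901), Ch. XII §§255–256.
* [NewtonThorneIHES2021b] J. Newton, J. A. Thorne, *Symmetric power functoriality for
  holomorphic modular forms, II*, Publ. Math. IHÉS 134 (2021), proof of Prop. 3.7.
-/

open scoped MatrixGroups OnePoint Pointwise
open Matrix MulAction

namespace Literature.GroupTheory.SpecificGroups.PGL2

open Literature.NumberTheory.GaloisRepresentations

variable {k : Type*} [Field k]

local notation "M₂" => Matrix (Fin 2) (Fin 2) k


section SubfieldGroups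

variable (F : Subfield k)

/-- **`PGL₂(F) ≤ PGL₂(k)`** for a subfield `F ≤ k`: the image of `PGL₂(F) → PGL₂(k)`.
[cite: Faber2011, Thm. 6.1] -/
def pglTwo (F : Subfield k) : Subgroup PGL(Fin 2, k) :=
  (Matrix.ProjGenLinGroup.map (n := Fin 2) F.subtype).range

/-- **`PSL₂(F) ≤ PGL₂(k)`** for a subfield `F ≤ k`: the image of `SL₂(F) → PGL₂(k)`.
[cite: Faber2011, Thm. 6.1] -/
def pslTwo (F : Subfield k) : Subgroup PGL(Fin 2, k) :=
  ((Matrix.ProjGenLinGroup.map (n := Fin 2) F.subtype).comp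
    (Matrix.SpecialLinearGroup.toPGL : SL(2, F) →* PGL(Fin 2, F))).range

/-- `PSL₂(F) ≤ PGL₂(F)`. [folklore] -/
theorem pslTwo_le_pglTwo : pslTwo F ≤ pglTwo F := by
  rintro _ ⟨s, rfl⟩
  exact ⟨Matrix.SpecialLinearGroup.toPGL s, rfl⟩

/-- A matrix with entries in `F` defines an element of `GL₂(F)` mapping to it. [folklore] -/
theorem exists_map_eq_of_forall_mem {g : GL (Fin 2) k} (hg : ∀ i j, g i j ∈ F) :
    ∃ g' : GL (Fin 2) F, Matrix.GeneralLinearGroup.map F.subtype g' = g := by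
  let M : Matrix (Fin 2) (Fin 2) F := Matrix.of fun i j => ⟨g i j, hg i j⟩
  have hmap : F.subtype.mapMatrix M = (g : M₂) := by
    ext i j
    rfl
  have hdet : M.det ≠ 0 := by
    intro h0
    apply GL2.det_ne_zero g
    rw [← hmap, ← RingHom.map_det, h0, map_zero]
  refine ⟨Matrix.GeneralLinearGroup.mkOfDetNeZero M hdet, ?_⟩
  ext i j
  rw [Matrix.GeneralLinearGroup.map_apply]
  rfl

/-- **Membership in `PGL₂(F)` from the entries**: a class with a representative having all
entries in `F` lies in `PGL₂(F)`. [folklore] -/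
theorem mk_mem_pglTwo_of_forall_mem {g : GL (Fin 2) k} (hg : ∀ i j, g i j ∈ F) :
    Matrix.ProjGenLinGroup.mk g ∈ pglTwo F := by
  obtain ⟨g', hg'⟩ := exists_map_eq_of_forall_mem F hg
  exact ⟨Matrix.ProjGenLinGroup.mk g', by rw [Matrix.ProjGenLinGroup.map_mk, hg']⟩

/-- **Membership in `PSL₂(F)` from the entries**: a class with a representative of determinant
`1` having all entries in `F` lies in `PSL₂(F)`. [folklore] -/
theorem mk_mem_pslTwo_of_forall_mem {g : GL (Fin 2) k} (hg : ∀ i j, g i j ∈ F)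
    (hdet : (g : M₂).det = 1) : Matrix.ProjGenLinGroup.mk g ∈ pslTwo F := by
  obtain ⟨g', hg'⟩ := exists_map_eq_of_forall_mem F hg
  have hdet' : (g' : Matrix (Fin 2) (Fin 2) F).det = 1 := by
    apply F.subtype.injective
    rw [RingHom.map_det, map_one]
    change ((Matrix.GeneralLinearGroup.map F.subtype g' : GL (Fin 2) k) : M₂).det = 1
    rw [hg', hdet]
  refine ⟨⟨(g' : Matrix (Fin 2) (Fin 2) F), hdet'⟩, ?_⟩
  rw [MonoidHom.comp_apply, Matrix.SpecialLinearGroup.toPGL, MonoidHom.comp_apply,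
    Matrix.ProjGenLinGroup.map_mk, ← hg']
  congr 1
  congr 1
  exact Units.ext rfl

/-- Translations by elements of `F` lie in `PSL₂(F)`. [folklore] -/
theorem transl_mem_pslTwo {β : k} (hβ : β ∈ F) : transl β ∈ pslTwo F := by
  rw [transl_apply]
  refine mk_mem_pslTwo_of_forall_mem F (fun i j => ?_) ?_
  · fin_cases i <;> fin_cases j <;>
      simp [Matrix.GeneralLinearGroup.upperRightHom_apply, hβ, F.one_mem, F.zero_mem]
  · simp [Matrix.GeneralLinearGroup.upperRightHom_apply, Matrix.det_fin_two_of]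

/-- Homotheties by squares of elements of `F` lie in `PSL₂(F)`: `[diag(η², 1)] = [diag(η, η⁻¹)]`.
[folklore] -/
theorem homoth_mul_self_mem_pslTwo {η : k} (hη : η ∈ F) (h0 : η ≠ 0) :
    homoth (Units.mk0 η h0 * Units.mk0 η h0) ∈ pslTwo F := by
  have hd : (!![η, (0 : k); 0, η⁻¹]).det ≠ 0 := by simp [Matrix.det_fin_two_of, h0]
  have heq : homoth (Units.mk0 η h0 * Units.mk0 η h0) =
      Matrix.ProjGenLinGroup.mk (Matrix.GeneralLinearGroup.mkOfDetNeZero _ hd) := by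
    rw [homoth_apply, GL2.mk_eq_mk_iff_smul]
    refine ⟨(Units.mk0 η h0)⁻¹, ?_⟩
    ext i j
    fin_cases i <;> fin_cases j <;> simp [Matrix.GeneralLinearGroup.mkOfDetNeZero]
    · field_simp
  rw [heq]
  refine mk_mem_pslTwo_of_forall_mem F (fun i j => ?_) ?_
  · fin_cases i <;> fin_cases j <;>
      simp [Matrix.GeneralLinearGroup.mkOfDetNeZero, hη, F.zero_mem, F.inv_mem hη]
  · simp [Matrix.GeneralLinearGroup.mkOfDetNeZero, Matrix.det_fin_two_of, h0]

/-- Homotheties by elements of `F` lie in `PGL₂(F)`. [folklore] -/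
theorem homoth_mem_pglTwo {a : k} (ha : a ∈ F) (h0 : a ≠ 0) : homoth (Units.mk0 a h0) ∈ pglTwo F := by
  rw [homoth_apply]
  refine mk_mem_pglTwo_of_forall_mem F (fun i j => ?_)
  fin_cases i <;> fin_cases j <;> simp [ha, F.one_mem, F.zero_mem]

/-- **`|PGL₂(F)| = q(q² - 1)`** for a finite subfield `F` of order `q` (`PGL₂(F) → PGL₂(k)` is
injective). [folklore] -/
theorem card_pglTwo [Finite F] : Nat.card (pglTwo F) = Nat.card F * (Nat.card F ^ 2 - 1) := by
  haveI : Fintype F := Fintype.ofFinite F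
  rw [pglTwo, ← Nat.card_congr (MonoidHom.ofInjective
    (Serre1972.projGenLinGroup_map_injective F.subtype)).toEquiv,
    Literature.NumberTheory.Automorphic.NewtonThorne2021.natCard_projGenLinGroup_fin_two,
    Nat.card_eq_fintype_card]

variable (p : ℕ) [Fact p.Prime] [CharP k p]

omit [Fact (Nat.Prime p)] in
/-- **`2 |PSL₂(F)| = q(q² - 1)`** for a finite subfield `F` of odd characteristic
(`[PGL₂(F) : PSL₂(F)] = 2`, `NewtonThorne2021.index_range_toPGL`). [folklore] -/
theorem two_mul_card_pslTwo [Finite F] (hp : p ≠ 2) :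
    2 * Nat.card (pslTwo F) = Nat.card F * (Nat.card F ^ 2 - 1) := by
  classical
  haveI : Fintype F := Fintype.ofFinite F
  have hchar : ringChar F ≠ 2 := by
    haveI : CharP F p := inferInstance
    rw [ringChar.eq F p]
    exact hp
  have hidx := Literature.NumberTheory.Automorphic.NewtonThorne2021.index_range_toPGL hchar
  have hmul := Subgroup.card_mul_index
    (Matrix.SpecialLinearGroup.toPGL : SL(2, F) →* PGL(Fin 2, F)).range
  rw [hidx, Literature.NumberTheory.Automorphic.NewtonThorne2021.natCard_projGenLinGroup_fin_two,
    ← Nat.card_eq_fintype_card] at hmul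
  rw [pslTwo, MonoidHom.range_comp, Subgroup.card_map_of_injective
    (Serre1972.projGenLinGroup_map_injective F.subtype), mul_comm]
  exact hmul

end SubfieldGroups

/-! ### Faber's normal form and the structure of `Λ` -/

section Normalised

variable [DecidableEq k] (p : ℕ) [Fact p.Prime] [CharP k p]

/-- **Faber's normal form** for a finite `p`-irregular `H ≤ PGL₂(k)` not fixing a point of
`ℙ¹(k)` (Faber 2011, §6: "we may conjugate `G` so that `P = (1 Γ; 0 1)` … After a suitable
conjugation of `G` we may suppose that `N = P ⋊ (μ_d(k) 0; 0 1)` … with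
`μ_d(k) ⊂ 𝔽_Γ^× ⊂ Γ ∖ {0}`"): a Sylow `p`-subgroup `P ≠ 1` fixes `∞` and is not normal, every
multiplier is realised by a homothety of `H`, and `1 ∈ Γ(H)`.  Every finite `H` with `p ∣ |H|`
not fixing a point is conjugate to one in normal form (parts I–II: `exists_smul_infty_eq`,
`exists_forall_homoth_mem_conj_transl`, `one_mem_Gamma_conj_homoth`). [cite: Faber2011, §6, Lemma 6.3] -/
structure IsNormalised (H : Subgroup PGL(Fin 2, k)) [Finite H] : Prop where
  /-- a non-trivial Sylow `p`-subgroup fixes `∞` -/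
  exists_sylow : ∃ P : Sylow p H, (P : Subgroup H) ≠ ⊥ ∧ (P : Subgroup H) ≤ stabilizer H (∞ : OnePoint k)
  /-- … and is not normal: `H` does not fix `∞` -/
  stabilizer_ne_top : stabilizer H (∞ : OnePoint k) ≠ ⊤
  /-- the complement fixes `0`: every multiplier is a homothety of `H` -/
  homoth_mem : ∀ a ∈ Lambda H, homoth a ∈ H
  /-- `1 ∈ Γ(H)` -/
  one_mem : (1 : k) ∈ Gamma H

namespace IsNormalised

variable {p} {H : Subgroup PGL(Fin 2, k)} [Finite H] (hN : IsNormalised p H)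
include hN

/-- `Γ(H) ≠ 0`. [folklore] -/
theorem Gamma_ne_bot : Gamma H ≠ ⊥ := by
  obtain ⟨P, hP1, hPi⟩ := hN.exists_sylow
  exact PGL2.Gamma_ne_bot p H P hP1 hPi

/-- `1 < q = |Γ(H)|`. [folklore] -/
theorem one_lt_card_Gamma : 1 < Nat.card (Gamma H) := by
  obtain ⟨P, hP1, hPi⟩ := hN.exists_sylow
  rw [card_Gamma_eq_card_sylow p H P hPi]
  exact (Subgroup.one_lt_card_iff_ne_bot _).mpr hP1

/-- The stabiliser field is finite. [folklore] -/
theorem finite_stabField : Finite (stabField (Gamma H)) := PGL2.finite_stabField hN.Gamma_ne_bot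

/-- **`|𝔽_Γ| = |Γ| = q`** (Faber's Lemma 6.3 in normal form). [cite: Faber2011, Lemma 6.3] -/
theorem card_stabField [IsAlgClosed k] : Nat.card (stabField (Gamma H)) = Nat.card (Gamma H) := by
  obtain ⟨P, hP1, hPi⟩ := hN.exists_sylow
  exact PGL2.card_stabField_eq p H P hP1 hPi hN.stabilizer_ne_top

/-- **`Γ(H) = 𝔽_q`**: in normal form the translation part is the stabiliser field itself
(Faber 2011, Lemma 6.3 (2): "`G` contains the Sylow `p`-subgroup `(1 𝔽_q; 0 1)`").
[cite: Faber2011, Lemma 6.3] -/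
theorem mem_Gamma_iff [IsAlgClosed k] {β : k} : β ∈ Gamma H ↔ β ∈ stabField (Gamma H) := by
  obtain ⟨P, hP1, hPi⟩ := hN.exists_sylow
  have := PGL2.coe_Gamma_eq_stabField p H P hP1 hPi hN.stabilizer_ne_top hN.one_mem
  rw [← SetLike.mem_coe, this, SetLike.mem_coe]

/-- Translations by `𝔽_q` lie in `H`. [cite: Faber2011, Lemma 6.3] -/
theorem transl_mem [IsAlgClosed k] {β : k} (hβ : β ∈ stabField (Gamma H)) : transl β ∈ H :=
  PGL2.mem_Gamma_iff.mp (hN.mem_Gamma_iff.mpr hβ)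

/-- **`d = q - 1`, or `p` odd and `2d = q - 1`** in normal form. [cite: Faber2011, Lemma 6.3] -/
theorem card_Lambda_eq_or [IsAlgClosed k] :
    Nat.card (Lambda H) = Nat.card (Gamma H) - 1 ∨
      (p ≠ 2 ∧ 2 * Nat.card (Lambda H) = Nat.card (Gamma H) - 1) := by
  obtain ⟨P, hP1, hPi⟩ := hN.exists_sylow
  rw [card_Gamma_eq_card_sylow p H P hPi]
  exact PGL2.card_Lambda_eq_or p H P hP1 hPi hN.stabilizer_ne_top

end IsNormalised

/-- The injective homomorphism `Λ(H) → 𝔽_Γˣ` (`Λ ⊆ 𝔽_Γ`). [cite: Faber2011, Lemma 6.3] -/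
def lambdaToUnits (H : Subgroup PGL(Fin 2, k)) [Finite H] : Lambda H →* (stabField (Gamma H))ˣ where
  toFun a := ⟨⟨(a : kˣ), coe_mem_stabField_of_mem_Lambda a.2⟩,
    ⟨((a : kˣ)⁻¹ : kˣ), coe_mem_stabField_of_mem_Lambda (inv_mem a.2)⟩,
    Subtype.ext (by simp), Subtype.ext (by simp)⟩
  map_one' := Units.ext (Subtype.ext rfl)
  map_mul' _ _ := Units.ext (Subtype.ext rfl)

/-- Unfolding of `lambdaToUnits`. [folklore] -/
@[simp] theorem coe_coe_lambdaToUnits (H : Subgroup PGL(Fin 2, k)) [Finite H] (a : Lambda H) :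
    ((lambdaToUnits H a : stabField (Gamma H)) : k) = ((a : kˣ) : k) := rfl

/-- `lambdaToUnits` is injective. [folklore] -/
theorem lambdaToUnits_injective (H : Subgroup PGL(Fin 2, k)) [Finite H] :
    Function.Injective (lambdaToUnits H) := by
  intro a b hab
  have := congrArg (fun u : (stabField (Gamma H))ˣ => ((u : stabField (Gamma H)) : k)) hab
  exact Subtype.ext (Units.ext this)

/-- `|image of Λ| = |Λ|`. [folklore] -/
theorem card_range_lambdaToUnits (H : Subgroup PGL(Fin 2, k)) [Finite H] :
    Nat.card (lambdaToUnits H).range = Nat.card (Lambda H) :=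
  (Nat.card_congr (MonoidHom.ofInjective (lambdaToUnits_injective H)).toEquiv).symm

namespace IsNormalised

variable {p} {H : Subgroup PGL(Fin 2, k)} [Finite H] (hN : IsNormalised p H)
include hN

/-- If `2d = q - 1` then the image of `Λ` in `𝔽_qˣ` has index `2`. [cite: Faber2011, Lemma 6.3] -/
theorem index_range_lambdaToUnits [IsAlgClosed k] (h2d : 2 * Nat.card (Lambda H) = Nat.card (Gamma H) - 1) :
    (lambdaToUnits H).range.index = 2 := by
  haveI := hN.finite_stabField
  have h2 := Subgroup.card_mul_index (lambdaToUnits H).range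
  rw [card_range_lambdaToUnits, Nat.card_units, hN.card_stabField, ← h2d, mul_comm] at h2
  have hd : 0 < Nat.card (Lambda H) := by
    haveI : Finite (Lambda H) := Finite.of_surjective _ (stabDeriv H).rangeRestrict_surjective
    exact Nat.card_pos
  exact Nat.eq_of_mul_eq_mul_right hd h2

/-- **If `2d = q - 1` then every square of `𝔽_qˣ` is a multiplier** (the image of `Λ` in
`𝔽_qˣ` has index `2`; Faber 2011, Lemma 6.3: "`Λ = (𝔽_qˣ)²`"). [cite: Faber2011, Lemma 6.3] -/
theorem mul_self_mem_Lambda [IsAlgClosed k] (h2d : 2 * Nat.card (Lambda H) = Nat.card (Gamma H) - 1)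
    {η : k} (hη : η ∈ stabField (Gamma H)) (h0 : η ≠ 0) :
    Units.mk0 η h0 * Units.mk0 η h0 ∈ Lambda H := by
  haveI := hN.finite_stabField
  have hidx := hN.index_range_lambdaToUnits h2d
  let u : (stabField (Gamma H))ˣ := Units.mk0 ⟨η, hη⟩ (fun h => h0 (congrArg Subtype.val h))
  have hmem : u ^ 2 ∈ (lambdaToUnits H).range := by
    rw [← hidx]
    exact Subgroup.pow_index_mem _ u
  obtain ⟨a, ha⟩ := MonoidHom.mem_range.mp hmem
  have : (a : kˣ) = Units.mk0 η h0 * Units.mk0 η h0 := by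
    apply Units.ext
    have := congrArg (fun v : (stabField (Gamma H))ˣ => ((v : stabField (Gamma H)) : k)) ha
    simp only [coe_coe_lambdaToUnits, Units.val_pow_eq_pow_val] at this
    rw [this, Units.val_mul, Units.val_mk0, sq]
    rfl
  rw [← this]
  exact a.2

/-- **If `2d = q - 1` (`p` odd) then every multiplier is a square of `𝔽_qˣ`** (both the image of
`Λ` and the squares have index `2` in `𝔽_qˣ`). [cite: Faber2011, Lemma 6.3] -/
theorem exists_mul_self_eq_of_mem_Lambda [IsAlgClosed k] (hp : p ≠ 2)
    (h2d : 2 * Nat.card (Lambda H) = Nat.card (Gamma H) - 1) {a : kˣ} (ha : a ∈ Lambda H) :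
    ∃ η ∈ stabField (Gamma H), ∃ h0 : η ≠ 0, Units.mk0 η h0 * Units.mk0 η h0 = a := by
  classical
  haveI := hN.finite_stabField
  haveI : Fintype (stabField (Gamma H)) := Fintype.ofFinite _
  have hchar : ringChar (stabField (Gamma H)) ≠ 2 := by
    haveI : CharP (stabField (Gamma H)) p := inferInstance
    rw [ringChar.eq (stabField (Gamma H)) p]
    exact hp
  have hSqidx : (powMonoidHom 2 : (stabField (Gamma H))ˣ →* (stabField (Gamma H))ˣ).range.index = 2 :=
    Literature.NumberTheory.Automorphic.NewtonThorne2021.index_range_powMonoidHom_two hchar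
  have hidx := hN.index_range_lambdaToUnits h2d
  -- squares are multipliers
  have hSqle : (powMonoidHom 2 : (stabField (Gamma H))ˣ →* (stabField (Gamma H))ˣ).range ≤
      (lambdaToUnits H).range := by
    intro w hw
    obtain ⟨v, rfl⟩ := MonoidHom.mem_range.mp hw
    have hv0 : ((v : stabField (Gamma H)) : k) ≠ 0 := fun h => v.ne_zero (Subtype.ext h)
    refine MonoidHom.mem_range.mpr ⟨⟨_, hN.mul_self_mem_Lambda h2d (v : stabField (Gamma H)).2 hv0⟩,
      Units.ext (Subtype.ext ?_)⟩
    rw [coe_coe_lambdaToUnits]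
    simp only [Units.val_mul, Units.val_mk0, powMonoidHom_apply, sq]
    rfl
  -- … and have the same (finite) order, hence coincide
  have hcard : Nat.card ((powMonoidHom 2 : (stabField (Gamma H))ˣ →* (stabField (Gamma H))ˣ).range) =
      Nat.card (lambdaToUnits H).range := by
    have h1 := Subgroup.card_mul_index (powMonoidHom 2 : (stabField (Gamma H))ˣ →* _).range
    have h2 := Subgroup.card_mul_index (lambdaToUnits H).range
    rw [hSqidx] at h1
    rw [hidx] at h2
    omega
  have heq := Subgroup.eq_of_le_of_card_ge hSqle hcard.ge
  have hmem : lambdaToUnits H ⟨a, ha⟩ ∈ (lambdaToUnits H).range := MonoidHom.mem_range.mpr ⟨_, rfl⟩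
  rw [← heq] at hmem
  obtain ⟨v, hv⟩ := MonoidHom.mem_range.mp hmem
  have hv0 : ((v : stabField (Gamma H)) : k) ≠ 0 := fun h => v.ne_zero (Subtype.ext h)
  refine ⟨(v : stabField (Gamma H)), (v : stabField (Gamma H)).2, hv0, Units.ext ?_⟩
  have := congrArg (fun u : (stabField (Gamma H))ˣ => ((u : stabField (Gamma H)) : k)) hv
  simp only [powMonoidHom_apply, Units.val_pow_eq_pow_val, coe_coe_lambdaToUnits] at this
  rw [Units.val_mul, Units.val_mk0, ← this, sq]
  rfl

end IsNormalised

end Normalised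

/-! ### The rationality computation of §6.1.1 -/

section Rationality

variable (F : Subfield k)

/-- **A subfield with more than `3` elements has an element `η ≠ 0` with `η² ≠ 1`** (the others
are roots of `X³ - X`). [cite: Faber2011, §6.1.1] -/
theorem exists_mem_ne_zero_sq_ne_one [Finite F] (hF : 3 < Nat.card F) :
    ∃ η ∈ F, η ≠ 0 ∧ η ^ 2 ≠ 1 := by
  classical
  by_contra hne
  push Not at hne
  haveI : Fintype F := Fintype.ofFinite F
  set P : Polynomial k := Polynomial.X ^ 3 - Polynomial.X with hP
  have hP0 : P ≠ 0 := by
    intro h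
    have := congrArg (Polynomial.coeff · 3) h
    simp [hP, Polynomial.coeff_X] at this
  have hdeg : P.natDegree ≤ 3 := by rw [hP]; compute_degree
  have hroots : ∀ μ ∈ (Finset.univ : Finset F).image (fun x : F => (x : k)), P.eval μ = 0 := by
    intro μ hμ
    obtain ⟨x, -, rfl⟩ := Finset.mem_image.mp hμ
    simp only [hP, Polynomial.eval_sub, Polynomial.eval_pow, Polynomial.eval_X]
    by_cases hx : (x : k) = 0
    · rw [hx]; ring
    · have := hne x x.2 hx
      linear_combination (x : k) * this
  have hcard := card_le_natDegree_of_forall_eval_eq_zero hP0 hroots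
  rw [Finset.card_image_of_injective _ Subtype.val_injective, Finset.card_univ,
    ← Nat.card_eq_fintype_card] at hcard
  omega

omit [Field k] in
/-- Two distinct elements of a two-element set exhaust it. [folklore] -/
theorem mem_and_mem_of_pair {α : Type*} {a b x y : α} (hxy : x ≠ y) (hx : x = a ∨ x = b)
    (hy : y = a ∨ y = b) {S : Set α} (hxS : x ∈ S) (hyS : y ∈ S) : a ∈ S ∧ b ∈ S := by
  rcases hx with rfl | rfl <;> rcases hy with rfl | rfl
  · exact absurd rfl hxy
  · exact ⟨hxS, hyS⟩
  · exact ⟨hyS, hxS⟩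
  · exact absurd rfl hxy

/-- **The roots of `cosetQuad`** for `det g = 1` and a square multiplier `a = η²`:
`cosetQuad g a (μ) = 0` iff `γ μ = ±2η - (g₀₀ η² + g₁₁)` (Faber 2011, §6.1:
"`α_i(η² - 1) + γ_i μ = -2 + 2η`", with both signs). [cite: Faber2011, §6.1] -/
theorem eval_cosetQuad_eq_zero_iff {g : GL (Fin 2) k} (hdet : (g : M₂).det = 1) (hγ : g 1 0 ≠ 0)
    {η : k} (h0 : η ≠ 0) (μ : k) :
    (cosetQuad g (Units.mk0 η h0 * Units.mk0 η h0)).eval μ = 0 ↔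
      μ = (2 * η - (g 0 0 * η ^ 2 + g 1 1)) / g 1 0 ∨
        μ = (-(2 * η) - (g 0 0 * η ^ 2 + g 1 1)) / g 1 0 := by
  rw [eval_cosetQuad, hdet, one_mul, Units.val_mul, Units.val_mk0]
  have key : (g 0 0 * (η * η) + g 1 0 * μ + g 1 1) ^ 2 - 4 * (η * η) =
      (g 1 0 * μ - (2 * η - (g 0 0 * η ^ 2 + g 1 1))) *
        (g 1 0 * μ - (-(2 * η) - (g 0 0 * η ^ 2 + g 1 1))) := by ring
  rw [key, mul_eq_zero, sub_eq_zero, sub_eq_zero, eq_div_iff hγ, eq_div_iff hγ, mul_comm μ]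

/-- **The rationality computation** (Faber 2011, §6.1.1): let `g = (α β; γ δ)` with `γ ≠ 0`,
`det g = 1`, `α + δ = 2`, over a field with `2 ≠ 0`; if for every `η ∈ F ∖ 0` both
`(±2η - (α η² + δ))/γ` lie in the subfield `F`, and `F` has an element `η₀ ≠ 0` with `η₀² ≠ 1`,
then all entries of `g` lie in `F` ("`γ_i = -4/μ_{i,-1} ∈ 𝔽_q` … Choose `η ≠ ±1`. Then
`α_i ∈ 𝔽_q`, and `δ_i = 2 - α_i ∈ 𝔽_q`. Since `det(s_i) = 1`, it follows that `β_i ∈ 𝔽_q`").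
[cite: Faber2011, §6.1.1] -/
theorem forall_mem_of_roots_mem (h2 : (2 : k) ≠ 0) {g : GL (Fin 2) k} (hγ : g 1 0 ≠ 0)
    (hdet : (g : M₂).det = 1) (htr : g 0 0 + g 1 1 = 2)
    (hroots : ∀ η ∈ F, η ≠ 0 →
      (2 * η - (g 0 0 * η ^ 2 + g 1 1)) / g 1 0 ∈ F ∧ (-(2 * η) - (g 0 0 * η ^ 2 + g 1 1)) / g 1 0 ∈ F)
    {η₀ : k} (hη₀ : η₀ ∈ F) (hη₀0 : η₀ ≠ 0) (hη₀1 : η₀ ^ 2 ≠ 1) : ∀ i j, g i j ∈ F := by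
  have h4 : (4 : k) ≠ 0 := by
    rw [show (4 : k) = 2 * 2 by norm_num]
    exact mul_ne_zero h2 h2
  have h4F : (4 : k) ∈ F := by exact_mod_cast natCast_mem F 4
  have h2F : (2 : k) ∈ F := by exact_mod_cast natCast_mem F 2
  -- `γ ∈ F`: `μ₊(1) - μ₋(1) = 4/γ`
  have hγF : g 1 0 ∈ F := by
    obtain ⟨hp1, hm1⟩ := hroots 1 F.one_mem one_ne_zero
    have hdiff := F.sub_mem hp1 hm1
    have heq : (2 * 1 - (g 0 0 * 1 ^ 2 + g 1 1)) / g 1 0 - (-(2 * 1) - (g 0 0 * 1 ^ 2 + g 1 1)) / g 1 0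
        = 4 / g 1 0 := by field_simp; ring
    rw [heq] at hdiff
    have hinv := F.inv_mem hdiff
    rw [inv_div] at hinv
    have := F.mul_mem hinv h4F
    rwa [div_mul_cancel₀ _ h4] at this
  -- `α η² + δ ∈ F` for every `η ∈ F ∖ 0`: `μ₊ + μ₋ = -2(αη² + δ)/γ`
  have hsum : ∀ η ∈ F, η ≠ 0 → g 0 0 * η ^ 2 + g 1 1 ∈ F := by
    intro η hη hη0
    obtain ⟨hp1, hm1⟩ := hroots η hη hη0
    have hadd := F.add_mem hp1 hm1
    have heq : (2 * η - (g 0 0 * η ^ 2 + g 1 1)) / g 1 0 + (-(2 * η) - (g 0 0 * η ^ 2 + g 1 1)) / g 1 0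
        = -(2 / g 1 0) * (g 0 0 * η ^ 2 + g 1 1) := by field_simp; ring
    rw [heq] at hadd
    have hc : -(2 / g 1 0) ∈ F := F.neg_mem (F.div_mem h2F hγF)
    have hc0 : -(2 / g 1 0) ≠ 0 := neg_ne_zero.mpr (div_ne_zero h2 hγ)
    have := F.mul_mem (F.inv_mem hc) hadd
    rwa [inv_mul_cancel_left₀ hc0] at this
  -- `α ∈ F` from `η₀` and `1`; then `δ`, `β`
  have hαF : g 0 0 ∈ F := by
    have h1 := hsum 1 F.one_mem one_ne_zero
    have h0 := hsum η₀ hη₀ hη₀0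
    have hdiff := F.sub_mem h0 h1
    have heq : g 0 0 * η₀ ^ 2 + g 1 1 - (g 0 0 * 1 ^ 2 + g 1 1) = g 0 0 * (η₀ ^ 2 - 1) := by ring
    rw [heq] at hdiff
    have hne : η₀ ^ 2 - 1 ≠ 0 := sub_ne_zero.mpr hη₀1
    have hmem : η₀ ^ 2 - 1 ∈ F := F.sub_mem (F.pow_mem hη₀ 2) F.one_mem
    have := F.mul_mem hdiff (F.inv_mem hmem)
    rwa [mul_inv_cancel_right₀ hne] at this
  have hδF : g 1 1 ∈ F := by
    have : g 1 1 = 2 - g 0 0 := by rw [← htr]; ring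
    rw [this]
    exact F.sub_mem h2F hαF
  have hβF : g 0 1 ∈ F := by
    rw [Matrix.det_fin_two] at hdet
    have : g 0 1 = (g 0 0 * g 1 1 - 1) / g 1 0 := by
      field_simp
      have : (g : M₂) 0 0 * (g : M₂) 1 1 - (g : M₂) 0 1 * (g : M₂) 1 0 = 1 := hdet
      linear_combination -this
    rw [this]
    exact F.div_mem (F.sub_mem (F.mul_mem hαF hδF) F.one_mem) hγF
  intro i j
  fin_cases i <;> fin_cases j
  · exact hαF
  · exact hβF
  · exact hγF
  · exact hδF

end Rationality

/-! ### §6.1.1: `2d = q - 1`, `p` odd, `q > 3` ⇒ `H = PSL₂(𝔽_q)` -/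

section CaseSquares

variable [DecidableEq k] (p : ℕ) [Fact p.Prime] [CharP k p]

omit [DecidableEq k] in
/-- A lift `g` with `g ^ p = 1` is unipotent: `tr g = 2` and `det g = 1`. [cite: Faber2011, §6.1] -/
theorem trace_eq_two_and_det_eq_one_of_pow_char_eq_one {g : GL (Fin 2) k} (hg : g ^ p = 1) :
    (g : M₂).trace = 2 ∧ (g : M₂).det = 1 := by
  have hNN := sub_one_mul_self_eq_zero_of_pow_char_eq_one p hg
  set N : M₂ := (g : M₂) - 1 with hN
  have htrN : N.trace = 0 := (Matrix.isNilpotent_trace_of_isNilpotent ⟨2, by rw [pow_two, hNN]⟩).eq_zero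
  have hdetN : N.det = 0 := by
    have : N.det ^ 2 = 0 := by rw [pow_two, ← det_mul, hNN, det_zero]
    exact pow_eq_zero_iff two_ne_zero |>.mp this
  have hg1 : (g : M₂) = 1 + N := by rw [hN]; abel
  refine ⟨?_, ?_⟩
  · rw [hg1, Matrix.trace_add, Matrix.trace_one, Fintype.card_fin, htrN]; norm_num
  · rw [hg1, det_one_add_fin_two, htrN, hdetN, add_zero, add_zero]

variable {H : Subgroup PGL(Fin 2, k)} [Finite H]

omit [Fact (Nat.Prime p)] [CharP k p] [Finite H] in
/-- An element of `Stab_H(∞)` is `τ_μ δ_a` with `μ` its shift and `a` its multiplier. [folklore] -/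
theorem coe_stabilizer_eq_transl_mul_homoth (n : stabilizer H (∞ : OnePoint k)) :
    ((n : H) : PGL(Fin 2, k)) =
      transl (shiftInfty ((n : H) : PGL(Fin 2, k))) * homoth (stabDeriv H n : kˣ) := by
  have hni := coe_stabilizer_smul_infty H n
  have hdec := eq_transl_shiftInfty_mul_homoth hni
  have hunit : Units.mk0 (derivInfty ((n : H) : PGL(Fin 2, k))) (derivInfty_ne_zero hni) =
      (stabDeriv H n : kˣ) := Units.ext rfl
  rwa [hunit] at hdec

namespace IsNormalised

variable {p} (hN : IsNormalised p H)
include hN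

/-- The translation part of an element of `Stab_H(∞)` lies in `𝔽_q` (normal form: the homothety
part lies in `H`). [cite: Faber2011, Lemma 6.3] -/
theorem shiftInfty_mem [IsAlgClosed k] (n : stabilizer H (∞ : OnePoint k)) :
    shiftInfty ((n : H) : PGL(Fin 2, k)) ∈ stabField (Gamma H) := by
  have hni := coe_stabilizer_smul_infty H n
  have hdec := eq_transl_shiftInfty_mul_homoth hni
  have hunit : Units.mk0 (derivInfty ((n : H) : PGL(Fin 2, k))) (derivInfty_ne_zero hni) =
      (stabDeriv H n : kˣ) := Units.ext rfl
  rw [hunit] at hdec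
  have hhom : homoth (stabDeriv H n : kˣ) ∈ H := hN.homoth_mem _ ⟨n, rfl⟩
  have ht : transl (shiftInfty ((n : H) : PGL(Fin 2, k))) ∈ H := by
    have := mul_mem (n : H).2 (inv_mem hhom)
    rwa [hdec, mul_inv_cancel_right] at this
  exact hN.mem_Gamma_iff.mp ht

omit [Finite H] hN in
/-- In normal form with `p` odd and `2d = q - 1`, the equality case of Lemma 6.3 holds.
[cite: Faber2011, §6.1] -/
theorem card_sylow_sub_one_eq (hp : p ≠ 2) (h2d : 2 * Nat.card (Lambda H) = Nat.card (Gamma H) - 1)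
    {P : Sylow p H} (hPi : (P : Subgroup H) ≤ stabilizer H (∞ : OnePoint k)) :
    Nat.card (P : Subgroup H) - 1 = (if p = 2 then 1 else 2) * Nat.card (Lambda H) := by
  rw [if_neg hp, ← card_Gamma_eq_card_sylow p H P hPi, h2d]

/-- **Two solutions per multiplier** (`p` odd, `2d = q - 1`): for `s ∈ H` not fixing `∞` and a
multiplier `l`, there are two distinct `n ∈ Stab_H(∞)` with multiplier `l` and `(s n)^p = 1`
(Faber 2011, §6.1: "there are exactly `ε_p > 0` elements `μ ∈ 𝔽_q` satisfying (6.0.3)").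
[cite: Faber2011, §6.1] -/
theorem exists_ne_and_fibre [IsAlgClosed k] (hp : p ≠ 2)
    (h2d : 2 * Nat.card (Lambda H) = Nat.card (Gamma H) - 1) {s : H}
    (hs : (s : PGL(Fin 2, k)) • (∞ : OnePoint k) ≠ ∞) {l : kˣ} (hl : l ∈ Lambda H) :
    ∃ n₁ n₂ : stabilizer H (∞ : OnePoint k), n₁ ≠ n₂ ∧
      ((stabDeriv H n₁ : kˣ) = l ∧ ((s : PGL(Fin 2, k)) * ((n₁ : H) : PGL(Fin 2, k))) ^ p = 1) ∧
      ((stabDeriv H n₂ : kˣ) = l ∧ ((s : PGL(Fin 2, k)) * ((n₂ : H) : PGL(Fin 2, k))) ^ p = 1) := by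
  obtain ⟨P, hP1, hPi⟩ := hN.exists_sylow
  have hle := eps_le_card_fibre_of_eq p H P hP1 hPi (card_sylow_sub_one_eq hp h2d hPi) hs hl
  rw [if_neg hp] at hle
  have hnt : Nontrivial {n : stabilizer H (∞ : OnePoint k) //
      (stabDeriv H n : kˣ) = l ∧ ((s : PGL(Fin 2, k)) * ((n : H) : PGL(Fin 2, k))) ^ p = 1} :=
    Finite.one_lt_card_iff_nontrivial.mp (by omega)
  obtain ⟨⟨n₁, h₁⟩, ⟨n₂, h₂⟩, hne⟩ := hnt
  exact ⟨n₁, n₂, fun h => hne (Subtype.ext h), h₁, h₂⟩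

/-- **A `p`-element of `H` not fixing `∞` lies in `PSL₂(𝔽_q)`** (`p` odd, `2d = q - 1`, `q > 3`;
Faber 2011, §6.1.1: its unipotent lift has all entries in `𝔽_q`). [cite: Faber2011, §6.1.1] -/
theorem mem_pslTwo_of_pow_char_eq_one [IsAlgClosed k] (hp : p ≠ 2)
    (h2d : 2 * Nat.card (Lambda H) = Nat.card (Gamma H) - 1) (hq : 3 < Nat.card (Gamma H)) {s : H}
    (hs : (s : PGL(Fin 2, k)) • (∞ : OnePoint k) ≠ ∞) (hsp : (s : PGL(Fin 2, k)) ^ p = 1) :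
    (s : PGL(Fin 2, k)) ∈ pslTwo (stabField (Gamma H)) := by
  have pp : p.Prime := Fact.out
  set F := stabField (Gamma H) with hF
  haveI := hN.finite_stabField
  -- a unipotent lift
  obtain ⟨g, hgs, hgp⟩ := KleinGeometry.exists_lift_pow_eq_one (s : PGL(Fin 2, k)) pp.pos hsp
  obtain ⟨htr, hdet⟩ := trace_eq_two_and_det_eq_one_of_pow_char_eq_one p hgp
  have hγ : g 1 0 ≠ 0 := by
    intro h0
    apply hs
    rw [← hgs, mk_smul_infty_eq_self_iff]
    exact h0
  have h2 : (2 : k) ≠ 0 := by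
    intro h
    have := (CharP.cast_eq_zero_iff k p 2).mp (by exact_mod_cast h)
    exact hp ((Nat.prime_dvd_prime_iff_eq pp Nat.prime_two).mp this)
  -- both roots lie in `F`, for every `η ∈ F ∖ 0`
  have hroots : ∀ η ∈ F, η ≠ 0 →
      (2 * η - (g 0 0 * η ^ 2 + g 1 1)) / g 1 0 ∈ F ∧ (-(2 * η) - (g 0 0 * η ^ 2 + g 1 1)) / g 1 0 ∈ F := by
    intro η hη hη0
    have hl := hN.mul_self_mem_Lambda h2d hη hη0
    obtain ⟨n₁, n₂, hne, ⟨hd₁, hp₁⟩, ⟨hd₂, hp₂⟩⟩ := hN.exists_ne_and_fibre hp h2d hs hl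
    set μ₁ := shiftInfty ((n₁ : H) : PGL(Fin 2, k)) with hμ₁
    set μ₂ := shiftInfty ((n₂ : H) : PGL(Fin 2, k)) with hμ₂
    have hμ₁F : μ₁ ∈ F := hN.shiftInfty_mem n₁
    have hμ₂F : μ₂ ∈ F := hN.shiftInfty_mem n₂
    have hμne : μ₁ ≠ μ₂ := by
      intro h
      apply hne
      apply Subtype.ext
      apply Subtype.ext
      refine eq_of_derivInfty_eq_of_shiftInfty_eq (coe_stabilizer_smul_infty H n₁)
        (coe_stabilizer_smul_infty H n₂) ?_ h
      have := congrArg (fun u : kˣ => (u : k)) (hd₁.trans hd₂.symm)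
      simpa using this
    have hroot : ∀ n : stabilizer H (∞ : OnePoint k), (stabDeriv H n : kˣ) = Units.mk0 η hη0 * Units.mk0 η hη0 →
        ((s : PGL(Fin 2, k)) * ((n : H) : PGL(Fin 2, k))) ^ p = 1 →
        (shiftInfty ((n : H) : PGL(Fin 2, k)) = (2 * η - (g 0 0 * η ^ 2 + g 1 1)) / g 1 0 ∨
          shiftInfty ((n : H) : PGL(Fin 2, k)) = (-(2 * η) - (g 0 0 * η ^ 2 + g 1 1)) / g 1 0) := by
      intro n hd hpn
      rw [coe_stabilizer_eq_transl_mul_homoth n, hd, ← mul_assoc, ← hgs,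
        mk_mul_transl_mul_homoth_pow_char_eq_one_iff p] at hpn
      exact (eval_cosetQuad_eq_zero_iff hdet hγ hη0 _).mp hpn
    exact mem_and_mem_of_pair hμne (hroot n₁ hd₁ hp₁) (hroot n₂ hd₂ hp₂) (S := (F : Set k)) hμ₁F hμ₂F
  -- an `η₀` with `η₀² ≠ 1`
  have hq' : 3 < Nat.card F := by rw [hF, hN.card_stabField]; exact hq
  obtain ⟨η₀, hη₀, hη₀0, hη₀1⟩ := exists_mem_ne_zero_sq_ne_one F hq'
  have htr' : g 0 0 + g 1 1 = 2 := by rw [← Matrix.trace_fin_two]; exact htr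
  have hent := forall_mem_of_roots_mem F h2 hγ hdet htr' hroots hη₀ hη₀0 hη₀1
  rw [← hgs]
  exact mk_mem_pslTwo_of_forall_mem F hent hdet

/-- **Elements of `Stab_H(∞)` lie in `PSL₂(𝔽_q)`** (`p` odd, `2d = q - 1`): `τ_μ δ_{η²}` with
`μ ∈ 𝔽_q`, `η ∈ 𝔽_qˣ`. [cite: Faber2011, §6.1.1] -/
theorem coe_stabilizer_mem_pslTwo [IsAlgClosed k] (hp : p ≠ 2)
    (h2d : 2 * Nat.card (Lambda H) = Nat.card (Gamma H) - 1) (n : stabilizer H (∞ : OnePoint k)) :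
    ((n : H) : PGL(Fin 2, k)) ∈ pslTwo (stabField (Gamma H)) := by
  rw [coe_stabilizer_eq_transl_mul_homoth n]
  obtain ⟨η, hη, h0, hηη⟩ := hN.exists_mul_self_eq_of_mem_Lambda hp h2d (a := (stabDeriv H n : kˣ)) ⟨n, rfl⟩
  rw [← hηη]
  exact mul_mem (transl_mem_pslTwo _ (hN.shiftInfty_mem n)) (homoth_mul_self_mem_pslTwo _ hη h0)

/-- **`H ≤ PSL₂(𝔽_q)`** (`p` odd, `2d = q - 1`, `q > 3`). [cite: Faber2011, §6.1.1] -/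
theorem le_pslTwo [IsAlgClosed k] (hp : p ≠ 2) (h2d : 2 * Nat.card (Lambda H) = Nat.card (Gamma H) - 1)
    (hq : 3 < Nat.card (Gamma H)) : H ≤ pslTwo (stabField (Gamma H)) := by
  intro h hh
  by_cases hhi : h • (∞ : OnePoint k) = ∞
  · exact hN.coe_stabilizer_mem_pslTwo hp h2d ⟨⟨h, hh⟩, by
      rw [mem_stabilizer_iff, Subgroup.smul_def]; exact hhi⟩
  · have h1 : (1 : kˣ) ∈ Lambda H := (Lambda H).one_mem
    obtain ⟨n₁, -, -, ⟨-, hp₁⟩, -⟩ := hN.exists_ne_and_fibre hp h2d (s := ⟨h, hh⟩) hhi h1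
    have hs : ((⟨h, hh⟩ * (n₁ : H) : H) : PGL(Fin 2, k)) • (∞ : OnePoint k) ≠ ∞ := by
      rw [Subgroup.coe_mul, mul_smul, coe_stabilizer_smul_infty H n₁]
      exact hhi
    have hmem := hN.mem_pslTwo_of_pow_char_eq_one hp h2d hq hs (by rw [Subgroup.coe_mul]; exact hp₁)
    have hn := hN.coe_stabilizer_mem_pslTwo hp h2d n₁
    rw [Subgroup.coe_mul] at hmem
    have := mul_mem hmem (inv_mem hn)
    rwa [mul_inv_cancel_right] at this

/-- **`|H| ≥ q d (q + 1)`** in normal form: `|Stab_H(∞)| = q d` and the number of cosets is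
`n_p ≡ 1 (mod q)`, `n_p > 1` (Faber 2011, §6.1: "`|G| = q(fq+1)(q-1)/ε_p`", `f ≥ 1`).
[cite: Faber2011, §6.1] -/
theorem mul_le_card [IsAlgClosed k] :
    Nat.card (Gamma H) * Nat.card (Lambda H) * (Nat.card (Gamma H) + 1) ≤ Nat.card H := by
  obtain ⟨P, hP1, hPi⟩ := hN.exists_sylow
  have hS := card_stabilizer_eq_card_translSubgroup_mul H
  rw [← sylow_eq_translSubgroup p H P hPi] at hS
  have hdvd := card_sylow_dvd_index_stabilizer_sub_one p H P hPi
  have hlt := Subgroup.one_lt_index_of_ne_top hN.stabilizer_ne_top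
  have hmul := Subgroup.card_mul_index (stabilizer H (∞ : OnePoint k))
  rw [card_Gamma_eq_card_sylow p H P hPi]
  obtain ⟨c, hc⟩ := hdvd
  have hc1 : 1 ≤ c := by
    by_contra h0
    push Not at h0
    interval_cases c
    omega
  have hidx : Nat.card (P : Subgroup H) + 1 ≤ (stabilizer H (∞ : OnePoint k)).index := by
    have : Nat.card (P : Subgroup H) * 1 ≤ Nat.card (P : Subgroup H) * c := Nat.mul_le_mul_left _ hc1
    omega
  calc Nat.card (P : Subgroup H) * Nat.card (Lambda H) * (Nat.card (P : Subgroup H) + 1)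
      ≤ Nat.card (P : Subgroup H) * Nat.card (Lambda H) * (stabilizer H (∞ : OnePoint k)).index :=
        Nat.mul_le_mul_left _ hidx
    _ = Nat.card H := by rw [← hmul, hS]; rfl

/-- **Faber 2011, §6.1.1: `H = PSL₂(𝔽_q)`.** Let `k` be algebraically closed of odd
characteristic `p` and `H ≤ PGL₂(k)` finite in normal form (`IsNormalised`) with `2 |Λ| = q - 1`
(the multipliers are the squares) and `q > 3`.  Then `H` is the image of `SL₂(𝔽_q)` for the
subfield `𝔽_q = 𝔽_{Γ(H)}` of `k` ("For `q > 2`, we will show that … `G ⊂ PSL₂(𝔽_q)`. Then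
`q(fq+1)(q-1)/ε_p = |G| ≤ |PSL₂(𝔽_q)| = q(q²-1)/ε_p`, so that `f = 1` and `G = PSL₂(𝔽_q)`").
[cite: Faber2011, Thm. 6.1, §6.1.1] -/
theorem eq_pslTwo [IsAlgClosed k] (hp : p ≠ 2) (h2d : 2 * Nat.card (Lambda H) = Nat.card (Gamma H) - 1)
    (hq : 3 < Nat.card (Gamma H)) : H = pslTwo (stabField (Gamma H)) := by
  classical
  haveI := hN.finite_stabField
  haveI : Fintype (stabField (Gamma H)) := Fintype.ofFinite _
  haveI : Finite (pslTwo (stabField (Gamma H))) :=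
    Finite.of_surjective _ (MonoidHom.rangeRestrict_surjective _)
  refine Subgroup.eq_of_le_of_card_ge (hN.le_pslTwo hp h2d hq) ?_
  have h2c := two_mul_card_pslTwo (stabField (Gamma H)) p hp
  rw [hN.card_stabField] at h2c
  have hle := hN.mul_le_card
  set q := Nat.card (Gamma H) with hqdef
  set d := Nat.card (Lambda H) with hddef
  have hsq : q ^ 2 - 1 = (q + 1) * (q - 1) := by simpa using Nat.sq_sub_sq q 1
  have h2 : 2 * Nat.card (pslTwo (stabField (Gamma H))) ≤ 2 * Nat.card H := by
    rw [h2c, hsq]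
    calc q * ((q + 1) * (q - 1)) = 2 * (q * d * (q + 1)) := by rw [← h2d]; ring
      _ ≤ 2 * Nat.card H := Nat.mul_le_mul_left 2 hle
  omega

end IsNormalised

end CaseSquares

end Literature.GroupTheory.SpecificGroups.PGL2
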